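import Summits.HubbardSuperconductivity.HubbardSuperconductivity.Theorems.AnisotropyChordStiffnessNearFarPairs
import Summits.HubbardSuperconductivity.HubbardSuperconductivity.Theorems.AnisotropyChordStiffnessLocalOps
import Literature.MathematicalPhysics.QuantumLattice.LiebRobinsonHastingsKomaSpectralProofs
import Literature.MathematicalPhysics.QuantumLattice.XYOrderGDProofs
import Literature.MathematicalPhysics.QuantumLattice.SpinSystemProofs

/-!
# Route `AnisotropyChord` / H0 rotor rung: stub K2 `FarFieldKernelDecay` DECOMPOSED and its time side PROVED
# (theory seat memo ROTOR-THEORY-8 §123; Sketch8 Parts T–U ported)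

The symmetrised filtered current kernel `F_{bb'} + F_{b'b}` as a frequency-side sum `freqSide` (`filteredKernel_symm_eq_freqSide`),
the time side `timeSide` = a sum of two commutator expectations `commExpect` (HK06 §3: **`timeSideBound_holds`**), the typed
inputs `TimeSideBound` (K2-T), `BondCurrentLiebRobinson` (K2-LR), `LaplaceSinLemma` (K2-L), and the compositions
`farFieldKernelDecay_of_laplace`, **`farFieldKernelDecay_of_LR : BondCurrentLiebRobinson Δ → LaplaceSinLemma → FarFieldKernelDecay Δ M`**.
Typing/proof authority: theory seat `hubbard-h0-rotor-theory-1`, cycle 8 (ported verbatim up to namespaces).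
-/


set_option linter.dupNamespace false

noncomputable section

open Matrix Complex Finset Filter Topology MeasureTheory
open scoped ComplexConjugate Matrix.Norms.L2Operator
open Literature.MathematicalPhysics.QuantumLattice hiding torusPhase torusNorm
open Literature.Probability.LatticeModels
open Summit.HubbardSuperconductivity.HubbardSuperconductivity.Theorems.AnisotropyChord.InsertionEntropy

namespace Summit.HubbardSuperconductivity.HubbardSuperconductivity.Theorems.AnisotropyChord.Stiffness

/-! ## (port of Sketch8 section LaplaceSplit) -/


/-- The pair spectral coefficient `γᵢ = conj⟨vᵢ, j_b ψ⟩·⟨vᵢ, j_{b'} ψ⟩` (`b = (x,j)`, `b' = (y,j')`). -/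
def pairGamma (L : ℕ) [NeZero L] (Δ : ℝ) (a : (TorusSite 2 L → Fin 2) → ℝ) (x : TorusSite 2 L)
    (j : Fin 2) (y : TorusSite 2 L) (j' : Fin 2) (i : TorusSite 2 L → Fin 2) : ℂ :=
  starRingEnd ℂ (bondAmp L Δ a x j i) * bondAmp L Δ a y j' i

/-- Frequency side `Σᵢ g_Ω(ωᵢ) · 2 Re γᵢ`. -/
def freqSide (L : ℕ) [NeZero L] (Δ M : ℝ) (a : (TorusSite 2 L → Fin 2) → ℝ) (Ω : ℝ)
    (x : TorusSite 2 L) (j : Fin 2) (y : TorusSite 2 L) (j' : Fin 2) : ℝ :=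
  ∑ i, lorentzFilter Ω (excitation L Δ M i) * (2 * (pairGamma L Δ a x j y j' i).re)

/-- Time side `S_{bb'}(t) = Σᵢ 2 Re γᵢ · sin(ωᵢ t)`. -/
def timeSide (L : ℕ) [NeZero L] (Δ M : ℝ) (a : (TorusSite 2 L → Fin 2) → ℝ)
    (x : TorusSite 2 L) (j : Fin 2) (y : TorusSite 2 L) (j' : Fin 2) (t : ℝ) : ℝ :=
  ∑ i, 2 * (pairGamma L Δ a x j y j' i).re * Real.sin (excitation L Δ M i * t)

/-- **K2-S (PROVED): symmetrisation makes the kernel real:** `F_{bb'} + F_{b'b} = Σᵢ g_Ω(ωᵢ)·2Re γᵢ`. -/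
theorem filteredKernel_symm_eq_freqSide (L : ℕ) [NeZero L] (Δ M : ℝ) (a : (TorusSite 2 L → Fin 2) → ℝ)
    (Ω : ℝ) (x : TorusSite 2 L) (j : Fin 2) (y : TorusSite 2 L) (j' : Fin 2) :
    filteredKernel L Δ M a Ω x j y j' + filteredKernel L Δ M a Ω y j' x j
      = ((freqSide L Δ M a Ω x j y j' : ℝ) : ℂ) := by
  unfold filteredKernel freqSide pairGamma
  push_cast
  rw [← Finset.sum_add_distrib]
  refine Finset.sum_congr rfl fun i _ => ?_
  have h : starRingEnd ℂ (bondAmp L Δ a y j' i) * bondAmp L Δ a x j i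
      = starRingEnd ℂ (starRingEnd ℂ (bondAmp L Δ a x j i) * bondAmp L Δ a y j' i) := by
    rw [map_mul, starRingEnd_self_apply, mul_comm]
  rw [h, ← mul_add, Complex.add_conj]
  push_cast
  ring

/-- Commutator expectation `h_{A,B}(t) = ⟨ψ, (A τ_t(B) − τ_t(B) A) ψ⟩` in the state `ψ = a` (HK06 §3; the tree's
`commutator_expect_eq_sum` is its spectral representation). -/
def commExpect (L : ℕ) [NeZero L] (Δ : ℝ) (a : (TorusSite 2 L → Fin 2) → ℝ) (A B : Op (TorusSite 2 L) 2)
    (t : ℝ) : ℂ :=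
  star (toC L a) ⬝ᵥ ((A * heisenbergEvolution (hcbHamiltonian L Δ) t B
    - heisenbergEvolution (hcbHamiltonian L Δ) t B * A) *ᵥ toC L a)

/-- The bond current of the bond `(x, x + e_j)`. -/
abbrev bondJ (L : ℕ) [NeZero L] (x : TorusSite 2 L) (j : Fin 2) : Op (TorusSite 2 L) 2 :=
  bondCurrent L x (x + Pi.single j 1)

/-- **STUB K2-T — TIME SIDE = COMMUTATORS** `|S_{bb'}(t)| ≤ ½(‖h_{j_b,j_{b'}}(t)‖ + ‖h_{j_{b'},j_b}(t)‖)`.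
Proof route: `commutator_expect_eq_sum` (tree, HK06 §3) with `ψ = a`, `E₀ = E₀(M)` (`ha.eigen`), `A = j_b`, `B = j_{b'}`;
`⟨ψ, j_b vᵢ⟩ = ∓conj⟨vᵢ, j_b ψ⟩` (`j_b` is skew-Hermitian as typed: `j = ½(S⁺S⁻ − h.c.)`), so
`h_{b,b'}(t) + h_{b',b}(t) = ∓2i·S_{bb'}(t)`; stated as a bound to be sign-free, for `L ≥ 2` (so that every bond has
two distinct sites and `j_bᴴ = −j_b`). PROVED below (`timeSideBound_holds`); size M. -/
def TimeSideBound (Δ : ℝ) (M : ℕ → ℝ) : Prop :=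
  ∀ (L : ℕ) [NeZero L] (a : (TorusSite 2 L → Fin 2) → ℝ), IsPerronSectorGroundAmplitude L Δ (M L - 1) a →
  2 ≤ L → ∀ (x : TorusSite 2 L) (j : Fin 2) (y : TorusSite 2 L) (j' : Fin 2) (t : ℝ),
    |timeSide L Δ (M L - 1) a x j y j' t|
      ≤ 1 / 2 * (‖commExpect L Δ a (bondJ L x j) (bondJ L y j') t‖
        + ‖commExpect L Δ a (bondJ L y j') (bondJ L x j) t‖)

/-- **STUB K2-LR — LIEB–ROBINSON FOR BOND CURRENTS** `‖[j_b, τ_t(j_{b'})]‖ ≤ min(2, C₀ e^{−μ d_∞(x,y) + v₀|t|})`.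
Proof route: `norm_comm_heisenbergEvolution_le_exp` (tree) for the XXZ interaction written as an `Interaction` on
`TorusSite 2 L` (`localHamiltonian Φ univ = hcbHamiltonian L Δ`, range `1`, `V = 2`, `J = 4·‖bond term‖`) with the
grading `Z ↦ ⌊d_∞(Z, far bond)⌋` (as in `TorusLiebRobinsonProofs`); the trivial bound `2‖j‖² ≤ 2`; `C₀ ≥ 2e^{2μ}` absorbs
overlapping bonds; size L (proved: `bondCurrentLiebRobinson_holds`). -/
def BondCurrentLiebRobinson (Δ : ℝ) : Prop :=
  ∃ C₀ : ℝ, 0 < C₀ ∧ ∃ μ : ℝ, 0 < μ ∧ ∃ v₀ : ℝ, 0 < v₀ ∧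
  ∀ (L : ℕ) [NeZero L] (x : TorusSite 2 L) (j : Fin 2) (y : TorusSite 2 L) (j' : Fin 2) (t : ℝ),
    ‖bondJ L x j * heisenbergEvolution (hcbHamiltonian L Δ) t (bondJ L y j')
        - heisenbergEvolution (hcbHamiltonian L Δ) t (bondJ L y j') * bondJ L x j‖
      ≤ min 2 (C₀ * Real.exp (-(μ * tdist L x y) + v₀ * |t|))

/-- **STUB K2-L — SCALAR LAPLACE LEMMA.** If a finite trigonometric sum `S(t) = Σᵢ rᵢ sin(ωᵢ t)` obeys
`|S(t)| ≤ min(B₀, C₀ e^{−A + v₀ t})` for `t ≥ 0`, then `|Σᵢ g_Ω(ωᵢ) rᵢ| ≤ (B₀/Ω) e^{−ΩA/(2v₀)} + (C₀/Ω) e^{−A/2}`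
(`g_Ω(ω) = ∫₀^∞ e^{−Ωt} sin(ωt) dt`; split at `t* = A/(2v₀)`: `∫₀^{t*} ≤ C₀e^{−A/2}/Ω`, `∫_{t*}^∞ ≤ B₀e^{−Ωt*}/Ω`).
Pure real analysis (Mathlib: `integral_exp_mul_complex` / `Real.integral_exp`…); size M (proved: `laplaceSinLemma_holds`). -/
def LaplaceSinLemma : Prop :=
  ∀ (ι : Type) [Fintype ι] (ω r : ι → ℝ) (Ω : ℝ), 0 < Ω →
  ∀ (B₀ C₀ A v₀ : ℝ), 0 ≤ B₀ → 0 ≤ C₀ → 0 < v₀ →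
    (∀ t : ℝ, 0 ≤ t → |∑ i, r i * Real.sin (ω i * t)| ≤ min B₀ (C₀ * Real.exp (-A + v₀ * t))) →
    |∑ i, lorentzFilter Ω (ω i) * r i|
      ≤ B₀ / Ω * Real.exp (-(Ω * A / (2 * v₀))) + C₀ / Ω * Real.exp (-(A / 2))

/-- `⟨ψ, ψ⟩ = 1` for a Perron amplitude. -/
theorem star_toC_dotProduct_self (L : ℕ) [NeZero L] {Δ M : ℝ} {a : (TorusSite 2 L → Fin 2) → ℝ}
    (ha : IsPerronSectorGroundAmplitude L Δ M a) : star (toC L a) ⬝ᵥ toC L a = 1 := by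
  have h := ha.unit
  have e : star (toC L a) ⬝ᵥ toC L a = ((∑ σ, a σ ^ 2 : ℝ) : ℂ) := by
    unfold toC
    simp only [dotProduct, Pi.star_apply, Complex.star_def, Complex.conj_ofReal]
    push_cast
    exact Finset.sum_congr rfl fun σ _ => by ring
  rw [e, h]; simp

/-- `d_∞` is symmetric (tree: `torusDist_comm'`). -/
theorem tdist_comm (L : ℕ) [NeZero L] (x y : TorusSite 2 L) : tdist L x y = tdist L y x := by
  unfold tdist; rw [torusDist_comm']

/-- **K2 PROVED FROM K2-T ∧ K2-LR ∧ K2-L** (`c = 2`, `v = v₀/μ`, `C_LR = C₀/2`). -/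
theorem farFieldKernelDecay_of_laplace (Δ : ℝ) (M : ℕ → ℝ) (hT : TimeSideBound Δ M)
    (hLR : BondCurrentLiebRobinson Δ) (hLap : LaplaceSinLemma) : FarFieldKernelDecay Δ M := by
  obtain ⟨C₀, hC₀, μ, hμ, v₀, hv₀, hLRb⟩ := hLR
  refine ⟨2, by norm_num, v₀ / μ, by positivity, μ, hμ, C₀ / 2, by positivity, ?_⟩
  refine (Filter.eventually_ge_atTop 2).mono fun L hL => ?_
  intro _inst a ha Ω hΩ x y j j'
  show ‖filteredKernel L Δ (M L - 1) a Ω x j y j' + filteredKernel L Δ (M L - 1) a Ω y j' x j‖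
    ≤ 2 / Ω * (Real.exp (-(Ω * tdist L x y / (2 * (v₀ / μ)))) + C₀ / 2 * Real.exp (-(μ * tdist L x y / 2)))
  have hunit : star (toC L a) ⬝ᵥ toC L a = 1 := star_toC_dotProduct_self L ha
  -- time side ≤ min(2, LR)
  have hS : ∀ t : ℝ, 0 ≤ t →
      |∑ i, 2 * (pairGamma L Δ a x j y j' i).re * Real.sin (excitation L Δ (M L - 1) i * t)|
        ≤ min 2 (C₀ * Real.exp (-(μ * tdist L x y) + v₀ * t)) := by
    intro t ht
    have h0 := hT L a ha hL x j y j' t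
    have e1 : ‖commExpect L Δ a (bondJ L x j) (bondJ L y j') t‖
        ≤ min 2 (C₀ * Real.exp (-(μ * tdist L x y) + v₀ * |t|)) := by
      unfold commExpect
      exact norm_commutator_expect_le_of_le hunit (by rw [norm_sub_rev]; exact hLRb L x j y j' t)
    have e2 : ‖commExpect L Δ a (bondJ L y j') (bondJ L x j) t‖
        ≤ min 2 (C₀ * Real.exp (-(μ * tdist L x y) + v₀ * |t|)) := by
      unfold commExpect
      rw [tdist_comm L x y]
      exact norm_commutator_expect_le_of_le hunit (by rw [norm_sub_rev]; exact hLRb L y j' x j t)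
    rw [abs_of_nonneg ht] at e1 e2
    have : |timeSide L Δ (M L - 1) a x j y j' t| ≤ min 2 (C₀ * Real.exp (-(μ * tdist L x y) + v₀ * t)) := by
      linarith
    simpa only [timeSide] using this
  have hF := hLap (TorusSite 2 L → Fin 2) (fun i => excitation L Δ (M L - 1) i)
    (fun i => 2 * (pairGamma L Δ a x j y j' i).re) Ω hΩ 2 C₀ (μ * tdist L x y) v₀ (by norm_num) hC₀.le hv₀ hS
  beta_reduce at hF
  rw [filteredKernel_symm_eq_freqSide, Complex.norm_real, Real.norm_eq_abs]
  unfold freqSide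
  have hμne : μ ≠ 0 := hμ.ne'
  have hv₀ne : v₀ ≠ 0 := hv₀.ne'
  have e1 : Real.exp (-(Ω * tdist L x y / (2 * (v₀ / μ)))) = Real.exp (-(Ω * (μ * tdist L x y) / (2 * v₀))) := by
    congr 1
    field_simp
  rw [e1]
  have hsplit : 2 / Ω * (Real.exp (-(Ω * (μ * tdist L x y) / (2 * v₀))) + C₀ / 2 * Real.exp (-(μ * tdist L x y / 2)))
      = 2 / Ω * Real.exp (-(Ω * (μ * tdist L x y) / (2 * v₀))) + C₀ / Ω * Real.exp (-(μ * tdist L x y / 2)) := by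
    ring
  rw [hsplit]
  exact hF


/-! ## (port of Sketch8 section TimeSide) -/


/-- For `L ≥ 2` a bond has two distinct endpoints. -/
theorem bond_ne (L : ℕ) [NeZero L] (hL : 2 ≤ L) (x : TorusSite 2 L) (j : Fin 2) :
    x ≠ x + Pi.single j 1 := by
  intro h
  have h1 : (Pi.single j (1 : ZMod L) : TorusSite 2 L) j = (0 : TorusSite 2 L) j := by
    have h' : x + Pi.single j 1 - x = (0 : TorusSite 2 L) := by rw [← h]; simp
    rw [add_sub_cancel_left] at h'
    rw [h']
  haveI : Fact (1 < L) := ⟨hL⟩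
  simp at h1

/-- `⟨ψ, A v⟩ = conj ⟨v, Aᴴ ψ⟩`. -/
theorem dotProduct_mulVec_eq_conj {n : Type*} [Fintype n] (A : Matrix n n ℂ) (ψ v : n → ℂ) :
    star ψ ⬝ᵥ (A *ᵥ v) = starRingEnd ℂ (star v ⬝ᵥ (Aᴴ *ᵥ ψ)) := by
  rw [Matrix.dotProduct_mulVec, show star ψ ᵥ* A = star (Aᴴ *ᵥ ψ) by
    rw [Matrix.star_mulVec, Matrix.conjTranspose_conjTranspose], star_dotProduct, starRingEnd_apply]

/-- `−2i sin z = e^{−iz} − e^{iz}`. -/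
theorem neg_two_I_mul_sin (z : ℂ) : -2 * Complex.I * Complex.sin z = cexp (-z * Complex.I) - cexp (z * Complex.I) := by
  simp only [Complex.sin]
  have hI : Complex.I * Complex.I = -1 := Complex.I_mul_I
  linear_combination (-(cexp (-z * Complex.I) - cexp (z * Complex.I))) * hI

/-- The per-eigenvalue identity behind K2-T. -/
theorem perTerm_identity (cx cy : ℂ) (θ : ℝ) :
    -(starRingEnd ℂ cx) * cy * cexp ((θ : ℂ) * Complex.I) - -(starRingEnd ℂ cy) * cx * cexp (-(θ : ℂ) * Complex.I)
      + (-(starRingEnd ℂ cy) * cx * cexp ((θ : ℂ) * Complex.I)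
        - -(starRingEnd ℂ cx) * cy * cexp (-(θ : ℂ) * Complex.I))
      = -2 * Complex.I * ((2 * (starRingEnd ℂ cx * cy).re * Real.sin θ : ℝ) : ℂ) := by
  push_cast
  rw [Complex.re_eq_add_conj, map_mul, starRingEnd_self_apply,
    show -2 * Complex.I * (2 * ((starRingEnd ℂ cx * cy + cx * starRingEnd ℂ cy) / 2) * Complex.sin (θ : ℂ))
      = (starRingEnd ℂ cx * cy + cx * starRingEnd ℂ cy) * (-2 * Complex.I * Complex.sin (θ : ℂ)) by ring,
    neg_two_I_mul_sin]
  ring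

/-- **K2-T: `h_{b,b'}(t) + h_{b',b}(t) = −2i·S_{bb'}(t)`** (HK06 spectral representation + skew-adjointness). -/
theorem commExpect_add_comm_eq (L : ℕ) [NeZero L] (hL : 2 ≤ L) (Δ : ℝ) (M : ℝ)
    (a : (TorusSite 2 L → Fin 2) → ℝ) (ha : IsPerronSectorGroundAmplitude L Δ M a)
    (x : TorusSite 2 L) (j : Fin 2) (y : TorusSite 2 L) (j' : Fin 2) (t : ℝ) :
    commExpect L Δ a (bondJ L x j) (bondJ L y j') t + commExpect L Δ a (bondJ L y j') (bondJ L x j) t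
      = -2 * Complex.I * ((timeSide L Δ M a x j y j' t : ℝ) : ℂ) := by
  have hψ : hcbHamiltonian L Δ *ᵥ toC L a
      = ((lowestEnergyInSector 1 (hcbHamiltonian L Δ) M : ℝ) : ℂ) • toC L a := ha.eigen
  have hA : (bondCurrent L x (x + Pi.single j 1))ᴴ = -bondCurrent L x (x + Pi.single j 1) :=
    bondCurrent_conjTranspose (bond_ne L hL x j)
  have hB : (bondCurrent L y (y + Pi.single j' 1))ᴴ = -bondCurrent L y (y + Pi.single j' 1) :=
    bondCurrent_conjTranspose (bond_ne L hL y j')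
  have e1 : ∀ i, star (toC L a) ⬝ᵥ (bondCurrent L x (x + Pi.single j 1) *ᵥ
        ⇑((hcbHamiltonian_isHermitian L Δ).eigenvectorBasis i))
      = -(starRingEnd ℂ (star ⇑((hcbHamiltonian_isHermitian L Δ).eigenvectorBasis i) ⬝ᵥ
          (bondCurrent L x (x + Pi.single j 1) *ᵥ toC L a))) := by
    intro i; rw [dotProduct_mulVec_eq_conj, hA, Matrix.neg_mulVec, dotProduct_neg, map_neg]
  have e2 : ∀ i, star (toC L a) ⬝ᵥ (bondCurrent L y (y + Pi.single j' 1) *ᵥ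
        ⇑((hcbHamiltonian_isHermitian L Δ).eigenvectorBasis i))
      = -(starRingEnd ℂ (star ⇑((hcbHamiltonian_isHermitian L Δ).eigenvectorBasis i) ⬝ᵥ
          (bondCurrent L y (y + Pi.single j' 1) *ᵥ toC L a))) := by
    intro i; rw [dotProduct_mulVec_eq_conj, hB, Matrix.neg_mulVec, dotProduct_neg, map_neg]
  dsimp only [bondJ]
  unfold commExpect timeSide pairGamma bondAmp excitation
  rw [commutator_expect_eq_sum (hcbHamiltonian_isHermitian L Δ) _ _ hψ t,
    commutator_expect_eq_sum (hcbHamiltonian_isHermitian L Δ) _ _ hψ t, ← Finset.sum_add_distrib,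
    Complex.ofReal_sum, Finset.mul_sum]
  refine Finset.sum_congr rfl fun i _ => ?_
  rw [e1 i, e2 i, mul_comm ((hcbHamiltonian_isHermitian L Δ).eigenvalues i
    - lowestEnergyInSector 1 (hcbHamiltonian L Δ) M) t]
  exact perTerm_identity _ _ _

/-- **K2-T PROVED.** -/
theorem timeSideBound_holds (Δ : ℝ) (M : ℕ → ℝ) : TimeSideBound Δ M := by
  intro L _ a ha hL x j y j' t
  have key := commExpect_add_comm_eq L hL Δ (M L - 1) a ha x j y j' t
  have hn : ‖commExpect L Δ a (bondJ L x j) (bondJ L y j') t + commExpect L Δ a (bondJ L y j') (bondJ L x j) t‖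
      = 2 * |timeSide L Δ (M L - 1) a x j y j' t| := by
    rw [key, norm_mul, Complex.norm_real, Real.norm_eq_abs]
    congr 1
    simp
  have htri := norm_add_le (commExpect L Δ a (bondJ L x j) (bondJ L y j') t)
    (commExpect L Δ a (bondJ L y j') (bondJ L x j) t)
  linarith

/-- **K2 from K2-LR ∧ K2-L alone** (K2-T discharged). -/
theorem farFieldKernelDecay_of_LR (Δ : ℝ) (M : ℕ → ℝ) (hLR : BondCurrentLiebRobinson Δ)
    (hLap : LaplaceSinLemma) : FarFieldKernelDecay Δ M :=
  farFieldKernelDecay_of_laplace Δ M (timeSideBound_holds Δ M) hLR hLap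


end Summit.HubbardSuperconductivity.HubbardSuperconductivity.Theorems.AnisotropyChord.Stiffness
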